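import Mathlib
import Summits.Langlands.Langlands.Theorems.QuadraticWindowHostInducedRepMemberSatakeData
import Summits.Langlands.Langlands.Theorems.QuadraticWindowHostInducedRepMemberSatakeKlein

/-!
# Sub-stub `stub_memberSatake` of the member statement (stub `stub_package`, line
# `one-transparent-pane`, crux `Summit.Langlands.Langlands.Theses.QuadraticWindow.HostInducedRep`,
# item stmt-Langlands-10902) — helper file 5: the pane representation `P = BC_{L/F}(π ⊗ ω) ⊗ (ψ₀ ∘ N)`
# at the unramified places, and its conjugate self-duality w.r.t. the pane involution `s`

LOG (wave-3 worker `stub_memberSatake`, 2026-08-16).  FACT-FREE (theorems only), on top of helper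
files 1 (`…MemberSatakeKlein`: pane automorphisms and places) and 3 (`…MemberSatakeData`: the a.e.
Satake data over `F₀`).

* §1 `pane_param`: at a place `𝔓` of `L` over `w = 𝔓 ∩ F`, `u = 𝔓 ∩ K` (with `u` unramified in `L`
  and `ψ₀` unramified at `u`), `Sat(P, 𝔓) = Sat(π ⊗ ω, w)^{f(𝔓|w)} · ψ₀(ϖ_u)^{f(𝔓|u)}` from the weak base
  change `P₀ = BC_{L/F}(π ⊗ ω)`, the twist `P = P₀ ⊗ ((ψ₀ ∘ N_{L/K}) ∘ det)` and
  `(ψ₀ ∘ N)(ϖ_𝔓) = ψ₀(ϖ_u)^{f(𝔓|u)}` (`compRelNorm_valueAtUniformizer`); `pair_prod_eq_pow`: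
  `χ(ϖ_w) χ(ϖ_{cw}) = χ|_{F₀}(ϖ_v)^{f(w|v)}` in a quadratic layer; the induced Satake polynomial over a
  fibre of one or two places.
* §2 `eventually_paneData`: the a.e. data of helper 3 at `v`, completed by the pane data above `v`
  (`v` and the `u ∣ v` unramified in `L`, `ψ₀` unramified at the `u ∣ v`, `Sat(P, 𝔓)` at every `𝔓 ∣ v`).
* §3 `isConjSelfDualAE_pane`: `Sat(P, s𝔓) = Sat(P, 𝔓)⁻¹` a.e. — with `s𝔓 ∩ F = τw`, `s𝔓 ∩ K = cK u`,
  `f(s𝔓|τw) = f(𝔓|w)`, `f(s𝔓|cKu) = f(𝔓|u)` and the polarization `Sat(π, τw) = α_w⁻¹ (χe(ϖ_v)q_v^k)^{f(w|v)}`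
  it is the scalar identity `[ψ₀(ϖ_u)ψ₀(ϖ_{cu})]^{f(𝔓|u)} [(χe(ϖ_v)q_v^k)^{f(w|v)} ω(ϖ_w)ω(ϖ_{τw})]^{f(𝔓|w)}
  = μ(ϖ_v)^{f(𝔓|v)} = 1` (`ψu(ϖ_u)ψu(ϖ_{cu}) = χ₀(ϖ_v)^{f(u|v)}`, `ω(ϖ_w)ω(ϖ_{τw}) = ω₀(ϖ_v)^{f(w|v)}`,
  `f(𝔓|v) = f(u|v)f(𝔓|u) = f(w|v)f(𝔓|w)`, and `μ(ϖ_v)² = 1`, `μ(ϖ_v) = 1` when `f(𝔓|v) = 1`).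
[cite: ArthurClozelAMS120, Ch. 3 Def. 1.1, Def. 6.1]
-/

open scoped BigOperators Polynomial Classical
open Filter Set Polynomial IsDedekindDomain NumberField
open Literature.NumberTheory.Automorphic Literature.NumberTheory.GaloisRepresentations
open Literature.NumberTheory.QuadraticForms Literature.NumberTheory.QuadraticForms.QuadraticExtension
open Summit.Langlands.Langlands.Theorems.HostInducedRep.GrsExplicitDescent
open Summit.Langlands.Langlands.Theorems.HostInducedRep.Negative

-- `Summit.Langlands.Langlands.…` (summit = sub-problem name, D-0017 layout) trips `dupNamespace`.
set_option linter.dupNamespace false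

noncomputable section

namespace Summit.Langlands.Langlands.Theorems.HostInducedRep.OneTransparentPane

/-! ## §1 The Satake parameters of the pane representation -/

section Param

variable {F₀ M : Type} [Field F₀] [NumberField F₀] [Field M] [NumberField M] [Algebra F₀ M]

/-- **`χ(ϖ_w) χ(ϖ_{cw}) = χ|_{F₀}(ϖ_v)^{f(w|v)}`** in a quadratic layer `M/F₀` with involution `c`
(`v = w ∩ 𝓞 F₀` unramified in `M`; `χ|(ϖ_v) = ∏_{w' ∣ v} χ(ϖ_{w'})`): split `v`: `f = 1` and the
fibre is `{w, cw}`; inert `v`: `f = 2`, `cw = w`. [folklore] -/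
theorem pair_prod_eq_pow (h2 : Module.finrank F₀ M = 2) {c : M ≃ₐ[F₀] M} (hc : c ≠ 1)
    {χ : HeckeCharacter M} {χ₀ : HeckeCharacter F₀} {v : HeightOneSpectrum (𝓞 F₀)}
    (hres : χ₀.valueAtUniformizer v = ∏ w ∈ (finite_fibre (F := M) v).toFinset, χ.valueAtUniformizer w)
    {w : HeightOneSpectrum (𝓞 M)} (hw : w.under (𝓞 F₀) = v) (hv : Algebra.IsUnramifiedIn (𝓞 M) v.asIdeal) :
    χ.valueAtUniformizer w * χ.valueAtUniformizer (c • w) =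
      χ₀.valueAtUniformizer v ^ w.asIdeal.inertiaDeg (𝓞 F₀) := by
  obtain ⟨h1, h2'⟩ := restrict_pair h2 hc hres hw
  by_cases hcw : c • w = w
  · rw [hcw, inertiaDeg_eq_two_of_smul_eq_of_isUnramifiedIn h2 hc hcw (by rw [hw]; exact hv), h2' hcw, sq]
  · rw [HeightOneSpectrum.inertiaDeg_eq_one_of_smul_ne h2 hcw, pow_one, h1 hcw]

omit [NumberField F₀] [NumberField M] in
/-- The induced Satake polynomial over a fibre consisting of ONE place `w₀`. [folklore] -/
theorem inducedSatakePolynomial_single {v : HeightOneSpectrum (𝓞 F₀)} {w₀ : HeightOneSpectrum (𝓞 M)}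
    (hfib : ∀ w : HeightOneSpectrum (𝓞 M), w.under (𝓞 F₀) = v ↔ w = w₀)
    (A : HeightOneSpectrum (𝓞 M) → Multiset ℂ) :
    inducedSatakePolynomial v A = (satakePolynomial (A w₀)).comp (X ^ w₀.asIdeal.inertiaDeg (𝓞 F₀)) := by
  have hset : {w : HeightOneSpectrum (𝓞 M) | w.asIdeal.under (𝓞 F₀) = v.asIdeal} = {w₀} := by
    ext w
    simp only [Set.mem_setOf_eq, Set.mem_singleton_iff, ← place_under_eq_iff_asIdeal, hfib]
  rw [inducedSatakePolynomial, hset, finprod_mem_singleton]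

omit [NumberField F₀] [NumberField M] in
/-- The induced Satake polynomial over a fibre consisting of TWO places `w₀ ≠ w₁`. [folklore] -/
theorem inducedSatakePolynomial_pair {v : HeightOneSpectrum (𝓞 F₀)} {w₀ w₁ : HeightOneSpectrum (𝓞 M)}
    (hne : w₀ ≠ w₁) (hfib : ∀ w : HeightOneSpectrum (𝓞 M), w.under (𝓞 F₀) = v ↔ (w = w₀ ∨ w = w₁))
    (A : HeightOneSpectrum (𝓞 M) → Multiset ℂ) :
    inducedSatakePolynomial v A = (satakePolynomial (A w₀)).comp (X ^ w₀.asIdeal.inertiaDeg (𝓞 F₀)) *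
      (satakePolynomial (A w₁)).comp (X ^ w₁.asIdeal.inertiaDeg (𝓞 F₀)) := by
  have hset : {w : HeightOneSpectrum (𝓞 M) | w.asIdeal.under (𝓞 F₀) = v.asIdeal} = {w₀, w₁} := by
    ext w
    simp only [Set.mem_setOf_eq, Set.mem_insert_iff, Set.mem_singleton_iff, ← place_under_eq_iff_asIdeal, hfib]
  rw [inducedSatakePolynomial, hset, finprod_mem_pair hne]

variable {K L : Type} [Field K] [NumberField K] [Field L] [NumberField L] [Algebra K L] [IsGalois K L]
  {F : Type} [Field F] [Algebra F L]

/-- **The Satake parameter of the pane representation at `𝔓`.**  If `P₀` has the parameter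
`A^{f(𝔓|w)}` at `𝔓` (base change from `w = 𝔓 ∩ F`), `P = P₀ ⊗ ((ψ₀ ∘ N_{L/K}) ∘ det)` at `𝔓`
(twist relation), `u = 𝔓 ∩ K` is unramified in `L` and `ψ₀` is unramified at `u`, then `P` has the
parameter `A^{f(𝔓|w)} · ψ₀(ϖ_u)^{f(𝔓|u)}` at `𝔓` (`(ψ₀ ∘ N)(ϖ_𝔓) = ψ₀(ϖ_u)^{e f} = ψ₀(ϖ_u)^{f(𝔓|u)}`,
`HeckeCharacter.compRelNorm_valueAtUniformizer`). [cite: ArthurClozelAMS120, Ch. 3 Def. 1.1] -/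
theorem pane_param {n : ℕ} {hL : isCompact_glFiniteIntegralLevel n L}
    {P₀ P : AutomorphicRepData (AutomorphyDatum.gl n L hL)} {ψ₀ : HeckeCharacter K}
    {𝔓 : HeightOneSpectrum (𝓞 L)} {A : Multiset ℂ}
    (hP₀ : P₀.HasSatakeParamAt 𝔓 (A.map (· ^ 𝔓.asIdeal.inertiaDeg (𝓞 F))))
    (htw : ∀ A' : Multiset ℂ, P₀.HasSatakeParamAt 𝔓 A' →
      P.HasSatakeParamAt 𝔓 (A'.map ((ψ₀.compRelNorm L).valueAtUniformizer 𝔓 * ·)))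
    (hunr : Algebra.IsUnramifiedIn (𝓞 L) (𝔓.under (𝓞 K)).asIdeal)
    (hψ : ψ₀.IsUnramifiedAt (𝔓.under (𝓞 K))) :
    P.HasSatakeParamAt 𝔓 ((A.map (· ^ 𝔓.asIdeal.inertiaDeg (𝓞 F))).map
      (ψ₀.valueAtUniformizer (𝔓.under (𝓞 K)) ^ 𝔓.asIdeal.inertiaDeg (𝓞 K) * ·)) := by
  have h := htw _ hP₀
  have hval : (ψ₀.compRelNorm L).valueAtUniformizer 𝔓 =
      ψ₀.valueAtUniformizer (𝔓.under (𝓞 K)) ^ 𝔓.asIdeal.inertiaDeg (𝓞 K) := by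
    rw [HeckeCharacter.compRelNorm_valueAtUniformizer ψ₀ (rfl : 𝔓.under (𝓞 K) = _) hunr hψ,
      ramificationIdxIn_eq_one_of_isUnramifiedIn hunr, one_mul,
      ← inertiaDeg_eq_inertiaDegIn_of_under_eq (𝔓.under (𝓞 K)) rfl]
    rfl
  rwa [hval] at h

end Param

/-! ## §2 The almost-everywhere pane data -/

section Pane

variable {F₀ F K L F' : Type} [Field F₀] [NumberField F₀] [Field F] [NumberField F] [Field K]
  [NumberField K] [Field L] [NumberField L] [Field F'] [NumberField F'] [Algebra F₀ F] [Algebra F₀ K]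
  [Algebra F₀ L] [Algebra F L] [Algebra K L] [Algebra F' L] [IsScalarTower F₀ F L] [IsScalarTower F₀ K L]
  [IsGalois K L]

/-- **The a.e. pane data** (see the module docstring, §2): the data of `eventually_memberData` at `v`,
`v` and the places `u ∣ v` of `K` unramified in `L` with `ψ₀ = ψu νk` unramified at `u`, and the Satake
parameter `Sat(π ⊗ ω, w)^{f(𝔓|w)} ψ₀(ϖ_u)^{f(𝔓|u)}` of `P` at every place `𝔓 ∣ v` of `L`
(`w = 𝔓 ∩ F`, `u = 𝔓 ∩ K`). [cite: ArthurClozelAMS120, Ch. 3 Def. 1.1, Def. 6.1] -/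
theorem eventually_paneData (hdeg : Module.finrank F₀ F = 2) {τ : F ≃ₐ[F₀] F} (hτ : τ ≠ 1) {n : ℕ}
    {hcpt : isCompact_glFiniteIntegralLevel n F}
    (π : CuspidalAutomorphicRepData n F hcpt) (e : FramedGaloisRep F₀ ℂ 1) (k : ℤ)
    (hpol : ∀ᶠ w in cofinite, ∀ (α β : Multiset ℂ) (c : ℂ), π.1.HasSatakeParamAt w α →
      π.1.HasSatakeParamAt (τ • w) β → e.HasFrobCharpolyAt (w.under (𝓞 F₀)) (X - C c) →
      β = α.map (fun a ↦ a⁻¹ * (c * ((w.under (𝓞 F₀)).residueCard : ℂ) ^ k) ^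
        w.asIdeal.inertiaDeg (𝓞 F₀)))
    {χe μ ω₀ : HeckeCharacter F₀} {ω : HeckeCharacter F} (hfin : ω.IsFiniteOrder)
    (hχe : ∀ v : HeightOneSpectrum (𝓞 F₀), e.IsUnramifiedAt v →
      χe.IsUnramifiedAt v ∧ e.HasFrobCharpolyAt v (X - C (χe.valueAtUniformizer v)))
    (hω₀ : ∀ x, ω₀ x = ω (AdeleRing.ideleBaseChange F₀ F x)) (hμ : MuHyp F K μ)
    {ψu νk : HeckeCharacter K}
    (hψures : ∀ x, ψu (AdeleRing.ideleBaseChange F₀ K x) = ((χe * ω₀)⁻¹ * μ) x)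
    {hF₀ : isCompact_glFiniteIntegralLevel (2 * n) F₀} {hK : isCompact_glFiniteIntegralLevel (2 * n) K}
    {hL : isCompact_glFiniteIntegralLevel n L}
    {Pind : AutomorphicRepData (AutomorphyDatum.gl (2 * n) F₀ hF₀)}
    {PiK τ' : AutomorphicRepData (AutomorphyDatum.gl (2 * n) K hK)}
    {P₀ P : AutomorphicRepData (AutomorphyDatum.gl n L hL)}
    (hAI : IsAutomorphicInductionAlong (π.twist ω hfin).1 Pind) (hBC : IsWeakBaseChangeLiftAE Pind PiK)
    (hW : τ'.W = PiK.W.map (mulChar (detTwist (2 * n) (ψu * νk))))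
    (hW' : τ'.W' = PiK.W'.map (mulChar (detTwist (2 * n) (ψu * νk))))
    (hP₀ : IsWeakBaseChangeLiftAE (π.twist ω hfin).1 P₀)
    (hPW : P.W = P₀.W.map (mulChar (detTwist n ((ψu * νk).compRelNorm L))))
    (hPW' : P.W' = P₀.W'.map (mulChar (detTwist n ((ψu * νk).compRelNorm L)))) :
    ∀ᶠ v : HeightOneSpectrum (𝓞 F₀) in cofinite,
      ∃ (α : HeightOneSpectrum (𝓞 F) → Multiset ℂ) (B : Multiset ℂ),
      (Algebra.IsUnramifiedIn (𝓞 F) v.asIdeal ∧ Algebra.IsUnramifiedIn (𝓞 K) v.asIdeal ∧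
      (∀ w : HeightOneSpectrum (𝓞 F), w.under (𝓞 F₀) = v →
        π.1.HasSatakeParamAt w (α w) ∧ ω.IsUnramifiedAt w ∧
        (π.twist ω hfin).1.HasSatakeParamAt w ((α w).map (ω.valueAtUniformizer w * ·)) ∧
        ∀ β : Multiset ℂ, π.1.HasSatakeParamAt (τ • w) β →
          β = (α w).map (fun a ↦ a⁻¹ * (χe.valueAtUniformizer v * (v.residueCard : ℂ) ^ k) ^
            w.asIdeal.inertiaDeg (𝓞 F₀))) ∧
      Pind.HasSatakeParamAt v B ∧
      satakePolynomial B = inducedSatakePolynomial v (fun w ↦ (α w).map (ω.valueAtUniformizer w * ·)) ∧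
      B.map (·⁻¹) = B.map (· * (χe.valueAtUniformizer v * (v.residueCard : ℂ) ^ k *
        ω₀.valueAtUniformizer v)⁻¹) ∧
      ((χe * ω₀)⁻¹ * μ).valueAtUniformizer v =
        (χe.valueAtUniformizer v * ω₀.valueAtUniformizer v)⁻¹ * μ.valueAtUniformizer v ∧
      μ.valueAtUniformizer v ^ 2 = 1 ∧
      ((v.asIdeal.primesOver (𝓞 K)).ncard = 2 → (v.asIdeal.primesOver (𝓞 F)).ncard = 2 →
        μ.valueAtUniformizer v = 1) ∧
      (∀ u : HeightOneSpectrum (𝓞 K), u.under (𝓞 F₀) = v → ψu.IsUnramifiedAt u ∧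
        PiK.HasSatakeParamAt u (B.map (· ^ u.asIdeal.inertiaDeg (𝓞 F₀))) ∧
        τ'.HasSatakeParamAt u
          ((B.map (· ^ u.asIdeal.inertiaDeg (𝓞 F₀))).map ((ψu * νk).valueAtUniformizer u * ·))) ∧
      ((χe * ω₀)⁻¹ * μ).valueAtUniformizer v =
        ∏ u ∈ (finite_fibre (F := K) v).toFinset, ψu.valueAtUniformizer u ∧
      ω₀.valueAtUniformizer v = ∏ w ∈ (finite_fibre (F := F) v).toFinset, ω.valueAtUniformizer w) ∧
      Algebra.IsUnramifiedIn (𝓞 L) v.asIdeal ∧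
      (∀ u : HeightOneSpectrum (𝓞 K), u.under (𝓞 F₀) = v →
        Algebra.IsUnramifiedIn (𝓞 L) u.asIdeal ∧ (ψu * νk).IsUnramifiedAt u) ∧
      (∀ 𝔓 : HeightOneSpectrum (𝓞 L), 𝔓.under (𝓞 F₀) = v →
        P.HasSatakeParamAt 𝔓 ((((α (𝔓.under (𝓞 F))).map
          (ω.valueAtUniformizer (𝔓.under (𝓞 F)) * ·)).map (· ^ 𝔓.asIdeal.inertiaDeg (𝓞 F))).map
          ((ψu * νk).valueAtUniformizer (𝔓.under (𝓞 K)) ^ 𝔓.asIdeal.inertiaDeg (𝓞 K) * ·))) := by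
  have hD := eventually_memberData hdeg hτ π e k hpol hfin hχe hω₀ hμ hψures hAI hBC hW hW'
  have hvL : ∀ᶠ v : HeightOneSpectrum (𝓞 F₀) in cofinite, Algebra.IsUnramifiedIn (𝓞 L) v.asIdeal := by
    filter_upwards [(finite_setOf_not_isUnramifiedIn F₀ L).compl_mem_cofinite] with v hv
    simpa using hv
  have huL : ∀ᶠ u : HeightOneSpectrum (𝓞 K) in cofinite, Algebra.IsUnramifiedIn (𝓞 L) u.asIdeal := by
    filter_upwards [(finite_setOf_not_isUnramifiedIn K L).compl_mem_cofinite] with u hu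
    simpa using hu
  have hL1 := eventually_forall_under_eq (F := F₀) (E := L) hP₀
  have hL2 := eventually_forall_under_eq (F := F₀) (E := L)
    (AutomorphicRepData.eventually_hasSatakeParamAt_of_map_mulChar_detTwist ((ψu * νk).compRelNorm L) hPW hPW')
  have hL3 := eventually_forall_under_eq (F := F₀)
    (huL.and (HeckeCharacter.isUnramifiedAt_cofinite_holds (ψu * νk)))
  filter_upwards [hD, hvL, hL1, hL2, hL3] with v hDv hvLv hv1 hv2 hv3
  obtain ⟨α, B, hdata⟩ := hDv
  refine ⟨α, B, hdata, hvLv, fun u hu ↦ hv3 u ((place_under_eq_iff_asIdeal u v).mp hu), fun 𝔓 h𝔓 ↦ ?_⟩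
  obtain ⟨-, -, hF, -⟩ := hdata
  have h𝔓' := (place_under_eq_iff_asIdeal 𝔓 v).mp h𝔓
  have hwv : (𝔓.under (𝓞 F)).under (𝓞 F₀) = v := (under_under_place 𝔓).trans h𝔓
  have huv : (𝔓.under (𝓞 K)).under (𝓞 F₀) = v := (under_under_place (F := K) 𝔓).trans h𝔓
  obtain ⟨-, -, htw, -⟩ := hF _ hwv
  obtain ⟨hunr, hψ⟩ := hv3 _ ((place_under_eq_iff_asIdeal _ v).mp huv)
  exact pane_param (hv1 𝔓 h𝔓' _ _ rfl htw) (hv2 𝔓 h𝔓') hunr hψ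

/-! ## §3 Conjugate self-duality of the pane representation almost everywhere -/

omit [NumberField F'] in
/-- **`P = BC_{L/F}(π ⊗ ω) ⊗ (ψ₀ ∘ N_{L/K})` is conjugate self-dual a.e. w.r.t. the pane involution
`s`**: `Sat(P, s𝔓) = Sat(P, 𝔓)⁻¹` at almost every place `𝔓` of `L` (see the module docstring, §3).
[cite: ArthurClozelAMS120, Ch. 3 Def. 1.1, Def. 6.1] -/
theorem isConjSelfDualAE_pane (hdeg : Module.finrank F₀ F = 2) {τ : F ≃ₐ[F₀] F} (hτ : τ ≠ 1)
    (h2K : Module.finrank F₀ K = 2) {cK : K ≃ₐ[F₀] K} (hcK : cK ≠ 1) {s : L ≃ₐ[F'] L}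
    (hT : IsPaneTower τ cK L F' s) {n : ℕ} {hcpt : isCompact_glFiniteIntegralLevel n F}
    (π : CuspidalAutomorphicRepData n F hcpt) (e : FramedGaloisRep F₀ ℂ 1) (k : ℤ)
    (hpol : ∀ᶠ w in cofinite, ∀ (α β : Multiset ℂ) (c : ℂ), π.1.HasSatakeParamAt w α →
      π.1.HasSatakeParamAt (τ • w) β → e.HasFrobCharpolyAt (w.under (𝓞 F₀)) (X - C c) →
      β = α.map (fun a ↦ a⁻¹ * (c * ((w.under (𝓞 F₀)).residueCard : ℂ) ^ k) ^
        w.asIdeal.inertiaDeg (𝓞 F₀)))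
    {χe μ ω₀ : HeckeCharacter F₀} {ω : HeckeCharacter F} (hfin : ω.IsFiniteOrder)
    (hχe : ∀ v : HeightOneSpectrum (𝓞 F₀), e.IsUnramifiedAt v →
      χe.IsUnramifiedAt v ∧ e.HasFrobCharpolyAt v (X - C (χe.valueAtUniformizer v)))
    (hω₀ : ∀ x, ω₀ x = ω (AdeleRing.ideleBaseChange F₀ F x)) (hμ : MuHyp F K μ)
    {ψu νk : HeckeCharacter K}
    (hψures : ∀ x, ψu (AdeleRing.ideleBaseChange F₀ K x) = ((χe * ω₀)⁻¹ * μ) x)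
    (hνk : ∀ x : ideleGroup K, ((νk x : ℂˣ) : ℂ) = ((ideleNorm x : ℝ) : ℂ) ^ ((k : ℂ) / 2))
    {hF₀ : isCompact_glFiniteIntegralLevel (2 * n) F₀} {hK : isCompact_glFiniteIntegralLevel (2 * n) K}
    {hL : isCompact_glFiniteIntegralLevel n L}
    {Pind : AutomorphicRepData (AutomorphyDatum.gl (2 * n) F₀ hF₀)}
    {PiK τ' : AutomorphicRepData (AutomorphyDatum.gl (2 * n) K hK)}
    {P₀ P : AutomorphicRepData (AutomorphyDatum.gl n L hL)}
    (hAI : IsAutomorphicInductionAlong (π.twist ω hfin).1 Pind) (hBC : IsWeakBaseChangeLiftAE Pind PiK)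
    (hW : τ'.W = PiK.W.map (mulChar (detTwist (2 * n) (ψu * νk))))
    (hW' : τ'.W' = PiK.W'.map (mulChar (detTwist (2 * n) (ψu * νk))))
    (hP₀ : IsWeakBaseChangeLiftAE (π.twist ω hfin).1 P₀)
    (hPW : P.W = P₀.W.map (mulChar (detTwist n ((ψu * νk).compRelNorm L))))
    (hPW' : P.W' = P₀.W'.map (mulChar (detTwist n ((ψu * νk).compRelNorm L)))) :
    P.IsConjSelfDualAE s := by
  obtain ⟨hFL, hKL, -, -, hsK, hsF, -, -⟩ := hT
  haveI : Algebra.IsQuadraticExtension F L := ⟨hFL⟩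
  haveI : IsGalois F L := Algebra.IsQuadraticExtension.isGalois F L
  haveI : Algebra.IsQuadraticExtension F₀ K := ⟨h2K⟩
  haveI : IsGalois F₀ K := Algebra.IsQuadraticExtension.isGalois F₀ K
  have hsF₀ : ∀ z : F₀, s (algebraMap F₀ L z) = algebraMap F₀ L z := fun z ↦ by
    rw [IsScalarTower.algebraMap_apply F₀ K L, hsK, AlgEquiv.commutes]
  have hD := eventually_paneData hdeg hτ π e k hpol hfin hχe hω₀ hμ hψures hAI hBC hW hW' hP₀ hPW hPW'
  change ∀ᶠ 𝔓 : HeightOneSpectrum (𝓞 L) in cofinite, ∀ α' β' : Multiset ℂ, P.HasSatakeParamAt 𝔓 α' →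
    P.HasSatakeParamAt (s • 𝔓) β' → β' = α'.map (·⁻¹)
  filter_upwards [eventually_under (E := L) (F := F₀) hD] with 𝔓 h𝔓 α' β' hα' hβ'
  obtain ⟨α, B, ⟨hv1, hv2, hF, -, -, -, hχ₀v, hμ2, hμ1, -, hres, hresω⟩, hvL, hKL', hP⟩ :=
    h𝔓 (𝔓.under (𝓞 F₀)) rfl
  set v := 𝔓.under (𝓞 F₀) with hvdef
  set cₑ := χe.valueAtUniformizer v with hcₑ
  set Q : ℂ := (v.residueCard : ℂ) ^ k with hQ
  -- the places below `𝔓` and `s𝔓`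
  have hwv : (𝔓.under (𝓞 F)).under (𝓞 F₀) = v := under_under_place 𝔓
  have huv : (𝔓.under (𝓞 K)).under (𝓞 F₀) = v := under_under_place (F := K) 𝔓
  have hs𝔓v : (s • 𝔓).under (𝓞 F₀) = v := (under_inertiaDeg_smul_of_fix hsF₀ 𝔓).1
  have hsw : (s • 𝔓).under (𝓞 F) = τ • 𝔓.under (𝓞 F) := under_smul_of_comm hsF 𝔓
  have hsu : (s • 𝔓).under (𝓞 K) = cK • 𝔓.under (𝓞 K) := under_smul_of_comm hsK 𝔓
  have hfw : (s • 𝔓).asIdeal.inertiaDeg (𝓞 F) = 𝔓.asIdeal.inertiaDeg (𝓞 F) :=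
    inertiaDeg_F_smul_of_comm hsF₀ hsF 𝔓
  have hfu : (s • 𝔓).asIdeal.inertiaDeg (𝓞 K) = 𝔓.asIdeal.inertiaDeg (𝓞 K) :=
    inertiaDeg_F_smul_of_comm (F := K) hsF₀ hsK 𝔓
  -- the polarization at `w = 𝔓 ∩ F`
  obtain ⟨-, -, -, hpol_w⟩ := hF (𝔓.under (𝓞 F)) hwv
  have hτwv : (τ • 𝔓.under (𝓞 F)).under (𝓞 F₀) = v := by rw [HeightOneSpectrum.under_algEquiv_smul, hwv]
  obtain ⟨hsat_τw, -, -, -⟩ := hF (τ • 𝔓.under (𝓞 F)) hτwv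
  have hατw : α (τ • 𝔓.under (𝓞 F)) = (α (𝔓.under (𝓞 F))).map
      (fun a ↦ a⁻¹ * (cₑ * Q) ^ (𝔓.under (𝓞 F)).asIdeal.inertiaDeg (𝓞 F₀)) := hpol_w _ hsat_τw
  -- the Satake parameters of `P` at `𝔓` and at `s𝔓`
  have hP𝔓 := hP 𝔓 rfl
  have hPs𝔓 := hP (s • 𝔓) hs𝔓v
  rw [hsw, hsu, hfw, hfu] at hPs𝔓
  rw [P.hasSatakeParamAt_unique_holds hβ' hPs𝔓, P.hasSatakeParamAt_unique_holds hα' hP𝔓, hατw]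
  simp only [Multiset.map_map, Function.comp_def]
  refine Multiset.map_congr rfl fun a _ ↦ ?_
  -- `f(𝔓|v) = f(u|v) f(𝔓|u) = f(w|v) f(𝔓|w)`
  have hf : (𝔓.under (𝓞 K)).asIdeal.inertiaDeg (𝓞 F₀) * 𝔓.asIdeal.inertiaDeg (𝓞 K) =
      (𝔓.under (𝓞 F)).asIdeal.inertiaDeg (𝓞 F₀) * 𝔓.asIdeal.inertiaDeg (𝓞 F) := by
    haveI : 𝔓.asIdeal.LiesOver (𝔓.under (𝓞 K)).asIdeal := ⟨rfl⟩
    haveI : 𝔓.asIdeal.LiesOver (𝔓.under (𝓞 F)).asIdeal := ⟨rfl⟩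
    rw [← Ideal.inertiaDeg_tower (𝔓.under (𝓞 K)).asIdeal 𝔓.asIdeal,
      ← Ideal.inertiaDeg_tower (𝔓.under (𝓞 F)).asIdeal 𝔓.asIdeal]
  have hcu_v : (cK • 𝔓.under (𝓞 K)).under (𝓞 F₀) = v := by rw [HeightOneSpectrum.under_algEquiv_smul, huv]
  have hqu : (𝔓.under (𝓞 K)).residueCard = v.residueCard ^ (𝔓.under (𝓞 K)).asIdeal.inertiaDeg (𝓞 F₀) := by
    rw [residueCard_eq_pow_inertiaDeg (F := F₀) (𝔓.under (𝓞 K)), huv]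
  have hqcu : (cK • 𝔓.under (𝓞 K)).residueCard = v.residueCard ^ (𝔓.under (𝓞 K)).asIdeal.inertiaDeg (𝓞 F₀) := by
    rw [residueCard_eq_pow_inertiaDeg (F := F₀) (cK • 𝔓.under (𝓞 K)), hcu_v,
      HeightOneSpectrum.inertiaDeg_algEquiv_smul]
  have hψpair := pair_prod_eq_pow h2K hcK hres huv hv2
  have hωpair := pair_prod_eq_pow hdeg hτ hresω hwv hv1
  have hQ0 : Q ≠ 0 := zpow_ne_zero _ (Nat.cast_ne_zero.mpr (zero_lt_one.trans v.one_lt_residueCard).ne')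
  have hce : cₑ ≠ 0 := Units.ne_zero _
  have hω₀0 : ω₀.valueAtUniformizer v ≠ 0 := Units.ne_zero _
  -- `ψ₀(ϖ_u) ψ₀(ϖ_{cu}) = ((χe ω₀)(ϖ_v)⁻¹ μ(ϖ_v) q_v^{-k})^{f(u|v)}`
  have hψ₀pair : (ψu * νk).valueAtUniformizer (𝔓.under (𝓞 K)) *
      (ψu * νk).valueAtUniformizer (cK • 𝔓.under (𝓞 K)) =
      ((cₑ * ω₀.valueAtUniformizer v)⁻¹ * μ.valueAtUniformizer v * Q⁻¹) ^
        (𝔓.under (𝓞 K)).asIdeal.inertiaDeg (𝓞 F₀) := by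
    rw [valueAtUniformizer_mul_normPow hνk, valueAtUniformizer_mul_normPow hνk, hqu, hqcu, mul_mul_mul_comm,
      hψpair, hχ₀v, ← sq, cpow_neg_half_sq, Nat.cast_pow, ← zpow_natCast ((v.residueCard : ℂ)), ← zpow_mul,
      mul_comm ((𝔓.under (𝓞 K)).asIdeal.inertiaDeg (𝓞 F₀) : ℤ) k, zpow_mul, zpow_natCast, ← inv_pow,
      ← mul_pow]
  -- `μ(ϖ_v)^{f(𝔓|v)} = 1`
  have hμf : μ.valueAtUniformizer v ^ ((𝔓.under (𝓞 K)).asIdeal.inertiaDeg (𝓞 F₀) * 𝔓.asIdeal.inertiaDeg (𝓞 K)) = 1 := by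
    rcases inertiaDeg_eq_one_or_two h2K (𝔓.under (𝓞 K)) with hK1 | hK2
    · rcases inertiaDeg_eq_one_or_two hKL 𝔓 with hu1 | hu2
      · -- `f(𝔓|v) = 1`: `v` splits in `F` and in `K`, so `μ(ϖ_v) = 1`
        have h1 : (𝔓.under (𝓞 F)).asIdeal.inertiaDeg (𝓞 F₀) * 𝔓.asIdeal.inertiaDeg (𝓞 F) = 1 := by
          rw [← hf, hK1, hu1]
        have hF1 := Nat.eq_one_of_mul_eq_one_right h1
        have hτw : τ • 𝔓.under (𝓞 F) ≠ 𝔓.under (𝓞 F) := fun h ↦ by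
          have h2 := inertiaDeg_eq_two_of_smul_eq_of_isUnramifiedIn hdeg hτ h (by rw [hwv]; exact hv1)
          omega
        have hcu : cK • 𝔓.under (𝓞 K) ≠ 𝔓.under (𝓞 K) := fun h ↦ by
          have h2 := inertiaDeg_eq_two_of_smul_eq_of_isUnramifiedIn h2K hcK h (by rw [huv]; exact hv2)
          omega
        have hKs := ncard_primesOver_eq_two_of_smul_ne h2K hcu
        have hFs := ncard_primesOver_eq_two_of_smul_ne hdeg hτw
        rw [huv] at hKs
        rw [hwv] at hFs
        rw [hμ1 hKs hFs, one_pow]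
      · rw [hu2, mul_comm, pow_mul, hμ2, one_pow]
    · rw [hK2, pow_mul, hμ2, one_pow]
  -- the scalar identity `[ψ₀ψ₀']^{f_u} [(cₑ q^k)^{f_F} ω ω']^{f_w} = 1`
  have hS : ((ψu * νk).valueAtUniformizer (𝔓.under (𝓞 K)) *
      (ψu * νk).valueAtUniformizer (cK • 𝔓.under (𝓞 K))) ^ 𝔓.asIdeal.inertiaDeg (𝓞 K) *
      ((cₑ * Q) ^ (𝔓.under (𝓞 F)).asIdeal.inertiaDeg (𝓞 F₀) * (ω.valueAtUniformizer (𝔓.under (𝓞 F)) *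
        ω.valueAtUniformizer (τ • 𝔓.under (𝓞 F)))) ^ 𝔓.asIdeal.inertiaDeg (𝓞 F) = 1 := by
    rw [hψ₀pair, hωpair, ← mul_pow, ← pow_mul, ← pow_mul, ← hf, ← mul_pow]
    have h1 : (cₑ * ω₀.valueAtUniformizer v)⁻¹ * μ.valueAtUniformizer v * Q⁻¹ *
        (cₑ * Q * ω₀.valueAtUniformizer v) = μ.valueAtUniformizer v := by
      field_simp
    rw [h1, hμf]
  have key : (ψu * νk).valueAtUniformizer (cK • 𝔓.under (𝓞 K)) ^ 𝔓.asIdeal.inertiaDeg (𝓞 K) *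
      (ω.valueAtUniformizer (τ • 𝔓.under (𝓞 F)) * (cₑ * Q) ^ (𝔓.under (𝓞 F)).asIdeal.inertiaDeg (𝓞 F₀)) ^
        𝔓.asIdeal.inertiaDeg (𝓞 F) =
      ((ψu * νk).valueAtUniformizer (𝔓.under (𝓞 K)) ^ 𝔓.asIdeal.inertiaDeg (𝓞 K) *
        ω.valueAtUniformizer (𝔓.under (𝓞 F)) ^ 𝔓.asIdeal.inertiaDeg (𝓞 F))⁻¹ := by
    refine eq_inv_of_mul_eq_one_left ?_
    rw [← hS]
    ring
  by_cases ha : a = 0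
  · have hfw0 : 𝔓.asIdeal.inertiaDeg (𝓞 F) ≠ 0 := by
      haveI : (𝔓.asIdeal.under (𝓞 F)).IsMaximal := (𝔓.under (𝓞 F)).isMaximal
      exact (Ideal.inertiaDeg_pos 𝔓.asIdeal (𝓞 F)).ne'
    subst ha
    simp [hfw0]
  · rw [show ω.valueAtUniformizer (τ • 𝔓.under (𝓞 F)) * (a⁻¹ * (cₑ * Q) ^ (𝔓.under (𝓞 F)).asIdeal.inertiaDeg (𝓞 F₀)) =
        (ω.valueAtUniformizer (τ • 𝔓.under (𝓞 F)) * (cₑ * Q) ^ (𝔓.under (𝓞 F)).asIdeal.inertiaDeg (𝓞 F₀)) * a⁻¹ by ring,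
      mul_pow _ a⁻¹, ← mul_assoc, key, mul_pow (ω.valueAtUniformizer (𝔓.under (𝓞 F))) a, inv_pow, ← mul_inv,
      mul_assoc]

end Pane

/-- **Registered anchor** of this helper file (stub registry of stmt-Langlands-10902, line
`one-transparent-pane`, helper "Pane" for `stub_memberSatake`): the induced Satake polynomial over a
one-place fibre. [folklore] -/
theorem memberSatakePane_anchor : ∀ (F₀ M : Type) [Field F₀] [Field M] [Algebra F₀ M] (v : HeightOneSpectrum (𝓞 F₀)) (w₀ : HeightOneSpectrum (𝓞 M)), (∀ w : HeightOneSpectrum (𝓞 M), w.under (𝓞 F₀) = v ↔ w = w₀) → ∀ (A : HeightOneSpectrum (𝓞 M) → Multiset ℂ), inducedSatakePolynomial v A = (satakePolynomial (A w₀)).comp (X ^ w₀.asIdeal.inertiaDeg (𝓞 F₀)) :=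
  fun _ _ _ _ _ _ _ hfib A ↦ inducedSatakePolynomial_single hfib A

end Summit.Langlands.Langlands.Theorems.HostInducedRep.OneTransparentPane

end
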